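import Mathlib
import HarnessLib
import Literature.Analysis.FluidPDE.LerayProfileCalculus
import Summits.NavierStokesRegularity.NavierStokesRegularity.Theorems.UnthreadedRigidityDoorUnthreadedRigidityHornPressureDefs
import Summits.NavierStokesRegularity.NavierStokesRegularity.Theorems.UnthreadedRigidityDoorUnthreadedRigidityVirialHornAngularTwo
import Summits.NavierStokesRegularity.NavierStokesRegularity.Theorems.UnthreadedRigidityDoorUnthreadedRigidityVirialHornShellFields
import Summits.NavierStokesRegularity.NavierStokesRegularity.Theorems.UnthreadedRigidityDoorUnthreadedRigidityVirialHornDegreeTwo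

/-!
# Route `UnthreadedRigidityDoor`, item `UnthreadedRigidity` (W2, stmt-NavierStokesRegularity-27585) — LINE g10-2 «PROFILE HORN»,
# BRIDGE PH (L-part `ThreadingJets.HornSliceIdentityTwo`), file 1: THE SOURCE OF THE SLICE POISSON EQUATION

Prover file (W2 Lean hand ns-crc-p1 g9, by lineage; `--supports stmt-NavierStokesRegularity-27585 --as helper`).  The slice pressure of
`HornSliceIdentityTwo` is pinned down by `Δp₀ = −σ`, `σ := div((u₀·∇)u₀)`, `u₀ = sepShell H Q x₀`, and decay.  This file computes `σ`
in closed form, CAS-free, in three stages: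

* STAGE 1 `trace_shellDeriv_comp_generic` — for the generic derivative `T = shellDeriv M z g A A′ B B′ Y` (`…HornPressureDefs`),
  `tr(T∘T)` as a polynomial in the invariants `⟪z,g⟫, |z|², |g|², z·Mg, z·Mz, g·Mz, tr M, tr M²` (fifteen terms; pure linear algebra);
* STAGE 2 `trace_shellDeriv_comp_quadY` — the `l = 2` shell data `M = 2Q`, `g = 2Qz`, `Y = Y_Q(z)`, `Q` symmetric traceless:
  `tr(T∘T) = Y²(16A′² + 4s²B′² + 11B² − 16sA′B′ − 8A′B − 8AB′ + 12sBB′) + 4W(4AA′ − 4sA′B − 2AB) + 4 tr Q²·A²`, `W = zᵀQ²z`, `s = |z|²`;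
* STAGE 3 `source_channels` — with `A = 2sh′ + 3h`, `A′ = 5h′ + 2sh″`, `B = 4h′`, `B′ = 4h″` (the shell `u₀(x₀+z) = A∇Y_Q − B Y_Q z`,
  `VirialHorn.curl_curl_shell_apply`) and the harmonic re-expansion `W = S₂ + (tr Q²/3)s`, `Y_Q² = S₄ + (4/7)sS₂ + (2/15)tr Q² s²`:
  `σ = tr Q²·ã₀(s) + ã₂(s)S₂(z) + ã₄(s)S₄(z)` with `ã₂ = chanTwo h` (= g7's `aTwo`, `ProfileHorn.aTwo_eq`), `ã₄ = chanFour h` (= `aFour`) and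
  the monopole `ã₀ = chanZero h` — so g7's engine-certified channels (kit j321644) are now KERNEL facts, and the radial channel is explicit.

Then `hasFDerivAt_sepShell` (the derivative of the shell at `x₀ + z` IS `shellDeriv (2Q) z (2Qz) A A′ B B′ Y_Q(z)`) and
`Literature.Analysis.FluidPDE.divergence_convect_self_eq` (`div((u·∇)u) = tr(Du∘Du)` for divergence-free `u`) give
★ `divergence_convect_sepShell : div((u₀·∇)u₀)(x₀ + z) = tr Q²·ã₀(|z|²) + ã₂(|z|²) S₂(z) + ã₄(|z|²) S₄(z)`.

HONEST LABEL: explicit-field calculus about SPECIAL (separable `l = 2`) slice data; a piece of the L-part of ONE bridge of a RUNG line on the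
wall item; `UnthreadedRigidity` (27585), W2 and NS regularity remain OPEN; nothing here is a statement about Navier–Stokes dynamics.  0 kit.
-/

-- the summit and its single sub-problem share the name (CONVENTIONS §1), as in every Theorems file
set_option linter.dupNamespace false

namespace Summit.NavierStokesRegularity.NavierStokesRegularity.Theorems.UnthreadedRigidity.HornPressure

open scoped RealInnerProductSpace Topology
open Filter Set
open Literature.Analysis.FluidPDE
open Summit.NavierStokesRegularity.NavierStokesRegularity.Theorems.UnthreadedRigidity.ProfileHorn (E3 IsQuadForm quadY discrCubic sepShell HornAdmissible)
open Summit.NavierStokesRegularity.NavierStokesRegularity.Theorems.UnthreadedRigidity.VirialHorn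

/-- `matCLM` in coordinates. -/
theorem matCLM_apply (M : Matrix (Fin 3) (Fin 3) ℝ) (v : E3) (i : Fin 3) :
    matCLM M v i = ∑ j : Fin 3, M i j * v j := by
  simp [matCLM, Fin.sum_univ_three]
  ring

/-- `shellDeriv` in coordinates. -/
theorem shellDeriv_apply (M : Matrix (Fin 3) (Fin 3) ℝ) (z g : E3) (A A' B B' Y : ℝ) (v : E3) (i : Fin 3) :
    shellDeriv M z g A A' B B' Y v i =
      A * (∑ j : Fin 3, M i j * v j) + 2 * A' * (∑ k : Fin 3, z k * v k) * g i
        - (B * Y * v i + (B * (∑ k : Fin 3, g k * v k) + 2 * B' * Y * (∑ k : Fin 3, z k * v k)) * z i) := by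
  simp [shellDeriv, matCLM_apply, PiLp.inner_apply, Fin.sum_univ_three]
  ring

/-- STAGE 1 (generic data): `tr(T∘T)` for `T = shellDeriv M z g A A' B B' Y`, in terms of the invariants
`⟪z,g⟫, |z|², |g|², z·Mg, z·Mz, g·Mz, tr M, tr M²` (written as coordinate sums). -/
theorem trace_shellDeriv_comp_generic (M : Matrix (Fin 3) (Fin 3) ℝ) (z g : E3) (A A' B B' Y : ℝ) :
    LinearMap.trace ℝ E3 ((shellDeriv M z g A A' B B' Y).comp (shellDeriv M z g A A' B B' Y) : E3 →ₗ[ℝ] E3) =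
      A ^ 2 * (∑ i : Fin 3, ∑ j : Fin 3, M i j * M j i)
      + 4 * A' ^ 2 * (∑ k : Fin 3, z k * g k) ^ 2
      + 4 * B' ^ 2 * Y ^ 2 * (∑ k : Fin 3, z k * z k) ^ 2
      + B ^ 2 * (∑ k : Fin 3, z k * g k) ^ 2 + 3 * B ^ 2 * Y ^ 2
      + 4 * A * A' * (∑ i : Fin 3, z i * ∑ j : Fin 3, M i j * g j)
      - 8 * A' * B' * Y * (∑ k : Fin 3, z k * z k) * (∑ k : Fin 3, z k * g k)
      - 4 * A' * B * (∑ k : Fin 3, z k * z k) * (∑ k : Fin 3, g k * g k)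
      - 4 * A' * B * Y * (∑ k : Fin 3, z k * g k)
      - 4 * A * B' * Y * (∑ i : Fin 3, z i * ∑ j : Fin 3, M i j * z j)
      - 2 * A * B * (∑ i : Fin 3, g i * ∑ j : Fin 3, M i j * z j)
      - 2 * A * B * Y * (∑ i : Fin 3, M i i)
      + 4 * B * B' * Y * (∑ k : Fin 3, z k * z k) * (∑ k : Fin 3, z k * g k)
      + 4 * B * B' * Y ^ 2 * (∑ k : Fin 3, z k * z k)
      + 2 * B ^ 2 * Y * (∑ k : Fin 3, z k * g k) := by
  rw [LinearMap.trace_eq_sum_inner _ (EuclideanSpace.basisFun (Fin 3) ℝ)]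
  simp (decide := true) only [ContinuousLinearMap.coe_comp, ContinuousLinearMap.coe_coe, Function.comp_apply,
    EuclideanSpace.basisFun_apply, EuclideanSpace.inner_single_left, map_one, one_mul, Fin.sum_univ_three,
    shellDeriv_apply, PiLp.single_apply, if_true, if_false, mul_one, mul_zero, add_zero, zero_add]
  ring

/-- STAGE 2 (the `l = 2` shell): with `M = 2Q`, `g = 2Qz = ∇Y_Q(z)`, `Y = Y_Q(z)` and `Q` symmetric traceless,
`tr(T∘T) = Y²·(16A′² + 4s²B′² + 11B² − 16sA′B′ − 8A′B − 8AB′ + 12sBB′) + 4W·(4AA′ − 4sA′B − 2AB) + 4τA²`,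
`s = |z|²`, `W = zᵀQ²z`, `τ = tr Q²`. -/
theorem trace_shellDeriv_comp_quadY {Q : Matrix (Fin 3) (Fin 3) ℝ} (hQ : IsQuadForm Q) (z : E3) (A A' B B' : ℝ) :
    LinearMap.trace ℝ E3 ((shellDeriv (2 • Q) z (matCLM (2 • Q) z) A A' B B' (quadY Q z)).comp
        (shellDeriv (2 • Q) z (matCLM (2 • Q) z) A A' B B' (quadY Q z)) : E3 →ₗ[ℝ] E3) =
      quadY Q z ^ 2 * (16 * A' ^ 2 + 4 * (‖z‖ ^ 2) ^ 2 * B' ^ 2 + 11 * B ^ 2 - 16 * ‖z‖ ^ 2 * A' * B'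
          - 8 * A' * B - 8 * A * B' + 12 * ‖z‖ ^ 2 * B * B')
        + 4 * (∑ i : Fin 3, (∑ j : Fin 3, Q i j * z j) ^ 2) * (4 * A * A' - 4 * ‖z‖ ^ 2 * A' * B - 2 * A * B)
        + 4 * Matrix.trace (Q * Q) * A ^ 2 := by
  have hs : ∀ i j : Fin 3, Q j i = Q i j := fun i j => by
    have := congrFun (congrFun hQ.1 i) j
    simpa [Matrix.transpose_apply] using this
  have h10 : Q 1 0 = Q 0 1 := hs 0 1
  have h20 : Q 2 0 = Q 0 2 := hs 0 2
  have h21 : Q 2 1 = Q 1 2 := hs 1 2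
  have htr : Q 2 2 = -Q 0 0 - Q 1 1 := by
    have h := hQ.2
    rw [Matrix.trace_fin_three] at h
    linarith
  have hn : ‖z‖ ^ 2 = z 0 * z 0 + z 1 * z 1 + z 2 * z 2 := by
    rw [EuclideanSpace.norm_eq, Real.sq_sqrt (Finset.sum_nonneg fun i _ => by positivity)]
    simp [Fin.sum_univ_three, Real.norm_eq_abs, pow_two]
  rw [trace_shellDeriv_comp_generic, Matrix.trace_fin_three]
  simp only [matCLM_apply, Matrix.smul_apply, Matrix.mul_apply, Fin.sum_univ_three, quadY, hn, h10, h20, h21, htr]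
  ring

/-- `S₂ = quadY (sqForm Q)` in coordinates: `zᵀQ²z − (tr Q²/3)|z|²` (`Q` symmetric). -/
theorem quadY_sqForm {Q : Matrix (Fin 3) (Fin 3) ℝ} (hQ : Q.IsSymm) (z : E3) :
    quadY (sqForm Q) z = (∑ i : Fin 3, (∑ j : Fin 3, Q i j * z j) ^ 2) - Matrix.trace (Q * Q) / 3 * ‖z‖ ^ 2 := by
  have hs : ∀ i j : Fin 3, Q j i = Q i j := fun i j => by
    have := congrFun (congrFun hQ i) j
    simpa [Matrix.transpose_apply] using this
  have h10 : Q 1 0 = Q 0 1 := hs 0 1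
  have h20 : Q 2 0 = Q 0 2 := hs 0 2
  have h21 : Q 2 1 = Q 1 2 := hs 1 2
  have hn : ‖z‖ ^ 2 = z 0 * z 0 + z 1 * z 1 + z 2 * z 2 := by
    rw [EuclideanSpace.norm_eq, Real.sq_sqrt (Finset.sum_nonneg fun i _ => by positivity)]
    simp [Fin.sum_univ_three, Real.norm_eq_abs, pow_two]
  unfold quadY sqForm
  rw [Matrix.trace_fin_three]
  simp only [Matrix.sub_apply, Matrix.mul_apply, Matrix.smul_apply, Matrix.one_apply, smul_eq_mul, Fin.sum_univ_three,
    hn, h10, h20, h21]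
  simp (decide := true) only [if_true, if_false, mul_one, mul_zero]
  ring

/-- STAGE 3 (harmonic re-expansion of the source): with the `l = 2` data `A = 2sh′ + 3h`, `A′ = 5h′ + 2sh″`, `B = 4h′`, `B′ = 4h″`
(`h, h′, h″` at `s = |z|²`), the closed form of STAGE 2 equals `tr Q²·ã₀(s) + ã₂(s)·S₂(z) + ã₄(s)·S₄(z)`. -/
theorem source_channels {Q : Matrix (Fin 3) (Fin 3) ℝ} (hQ : Q.IsSymm) (h : ℝ → ℝ) (z : E3) :
    quadY Q z ^ 2 * (16 * (5 * deriv h (‖z‖ ^ 2) + 2 * ‖z‖ ^ 2 * deriv (deriv h) (‖z‖ ^ 2)) ^ 2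
          + 4 * (‖z‖ ^ 2) ^ 2 * (4 * deriv (deriv h) (‖z‖ ^ 2)) ^ 2 + 11 * (4 * deriv h (‖z‖ ^ 2)) ^ 2
          - 16 * ‖z‖ ^ 2 * (5 * deriv h (‖z‖ ^ 2) + 2 * ‖z‖ ^ 2 * deriv (deriv h) (‖z‖ ^ 2)) * (4 * deriv (deriv h) (‖z‖ ^ 2))
          - 8 * (5 * deriv h (‖z‖ ^ 2) + 2 * ‖z‖ ^ 2 * deriv (deriv h) (‖z‖ ^ 2)) * (4 * deriv h (‖z‖ ^ 2))
          - 8 * (2 * ‖z‖ ^ 2 * deriv h (‖z‖ ^ 2) + 3 * h (‖z‖ ^ 2)) * (4 * deriv (deriv h) (‖z‖ ^ 2))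
          + 12 * ‖z‖ ^ 2 * (4 * deriv h (‖z‖ ^ 2)) * (4 * deriv (deriv h) (‖z‖ ^ 2)))
        + 4 * (∑ i : Fin 3, (∑ j : Fin 3, Q i j * z j) ^ 2)
          * (4 * (2 * ‖z‖ ^ 2 * deriv h (‖z‖ ^ 2) + 3 * h (‖z‖ ^ 2)) * (5 * deriv h (‖z‖ ^ 2) + 2 * ‖z‖ ^ 2 * deriv (deriv h) (‖z‖ ^ 2))
            - 4 * ‖z‖ ^ 2 * (5 * deriv h (‖z‖ ^ 2) + 2 * ‖z‖ ^ 2 * deriv (deriv h) (‖z‖ ^ 2)) * (4 * deriv h (‖z‖ ^ 2))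
            - 2 * (2 * ‖z‖ ^ 2 * deriv h (‖z‖ ^ 2) + 3 * h (‖z‖ ^ 2)) * (4 * deriv h (‖z‖ ^ 2)))
        + 4 * Matrix.trace (Q * Q) * (2 * ‖z‖ ^ 2 * deriv h (‖z‖ ^ 2) + 3 * h (‖z‖ ^ 2)) ^ 2 =
      Matrix.trace (Q * Q) * chanZero h (‖z‖ ^ 2) + chanTwo h (‖z‖ ^ 2) * quadY (sqForm Q) z
        + chanFour h (‖z‖ ^ 2) * quartic Q z := by
  simp only [chanZero, chanTwo, chanFour, quartic, quadY_sqForm hQ]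
  ring

/-- the gradient of `Y_Q` is the linear field `matCLM (2Q)`. -/
theorem gradient_quadY_eq_matCLM {Q : Matrix (Fin 3) (Fin 3) ℝ} (hQ : Q.IsSymm) :
    gradient (quadY Q) = fun z : E3 => matCLM (2 • Q) z := by
  rw [gradient_quadY hQ]
  funext z
  ext i
  rw [matCLM_apply]
  simp [Matrix.smul_apply, Finset.mul_sum, mul_assoc]

/-- THE SHELL IS THE TRANSLATE OF THE EXPLICIT CENTRED FIELD `a(|z|²)·2Qz − b(|z|²)Y_Q(z) z`, `a = 2sh′ + 3h`, `b = 4h′`. -/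
theorem sepShell_eq_explicit {Q : Matrix (Fin 3) (Fin 3) ℝ} (hQ : IsQuadForm Q) {H h : ℝ → ℝ} (hh : ContDiff ℝ (⊤ : ℕ∞) h)
    (hHh : ∀ r : ℝ, 0 ≤ r → H r = h (r ^ 2)) (x₀ : E3) :
    sepShell H Q x₀ = fun x : E3 =>
      (2 * ‖x - x₀‖ ^ 2 * deriv h (‖x - x₀‖ ^ 2) + 3 * h (‖x - x₀‖ ^ 2)) • matCLM (2 • Q) (x - x₀)
        - (4 * deriv h (‖x - x₀‖ ^ 2) * quadY Q (x - x₀)) • (x - x₀) := by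
  rw [sepShell_eq_sepShellL, sepShellL_eq_comp_sub hHh]
  funext x
  rw [curl_curl_shell_apply (hh.of_le (by norm_cast)) (isSolidHarmonic_quadY hQ), gradient_quadY_eq_matCLM hQ.1]
  norm_num

/-- THE DERIVATIVE OF THE SHELL at `x₀ + z` is `shellDeriv (2Q) z (2Qz) a a′ b b′ Y_Q(z)` with `a = 2sh′+3h`, `a′ = 5h′+2sh″`,
`b = 4h′`, `b′ = 4h″` at `s = |z|²`. -/
theorem hasFDerivAt_sepShell {Q : Matrix (Fin 3) (Fin 3) ℝ} (hQ : IsQuadForm Q) {H h : ℝ → ℝ} (hh : ContDiff ℝ (⊤ : ℕ∞) h)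
    (hHh : ∀ r : ℝ, 0 ≤ r → H r = h (r ^ 2)) (x₀ z : E3) :
    HasFDerivAt (sepShell H Q x₀)
      (shellDeriv (2 • Q) z (matCLM (2 • Q) z)
        (2 * ‖z‖ ^ 2 * deriv h (‖z‖ ^ 2) + 3 * h (‖z‖ ^ 2))
        (5 * deriv h (‖z‖ ^ 2) + 2 * ‖z‖ ^ 2 * deriv (deriv h) (‖z‖ ^ 2))
        (4 * deriv h (‖z‖ ^ 2)) (4 * deriv (deriv h) (‖z‖ ^ 2)) (quadY Q z)) (x₀ + z) := by
  have hd : Differentiable ℝ h := hh.differentiable (by simp)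
  have hd' : Differentiable ℝ (deriv h) := (contDiff_deriv_of_contDiff_top hh).differentiable (by simp)
  -- one-variable derivatives of `a(σ) = 2σ h′ + 3h` and `b(σ) = 4h′`
  have ha1 : ∀ σ : ℝ, HasDerivAt (fun σ => 2 * σ * deriv h σ + 3 * h σ)
      (5 * deriv h σ + 2 * σ * deriv (deriv h) σ) σ := by
    intro σ
    have h1 : HasDerivAt (fun σ : ℝ => 2 * σ) 2 σ := by simpa using (hasDerivAt_id σ).const_mul (2 : ℝ)
    have h2 := (h1.fun_mul (hd' σ).hasDerivAt).fun_add ((hd σ).hasDerivAt.const_mul 3)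
    exact h2.congr_deriv (by ring)
  have hb1 : ∀ σ : ℝ, HasDerivAt (fun σ => 4 * deriv h σ) (4 * deriv (deriv h) σ) σ :=
    fun σ => (hd' σ).hasDerivAt.const_mul 4
  -- derivatives in `z`
  have hN : HasFDerivAt (fun y : E3 => ‖y‖ ^ 2) (2 • innerSL ℝ z) z := (hasStrictFDerivAt_norm_sq z).hasFDerivAt
  have hA := (ha1 (‖z‖ ^ 2)).comp_hasFDerivAt z hN
  have hB := (hb1 (‖z‖ ^ 2)).comp_hasFDerivAt z hN
  have hG : HasFDerivAt (fun y : E3 => matCLM (2 • Q) y) (matCLM (2 • Q)) z := (matCLM (2 • Q)).hasFDerivAt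
  have hY : HasFDerivAt (quadY Q) (InnerProductSpace.toDual ℝ E3 (matCLM (2 • Q) z)) z := by
    have heq : matCLM (2 • Q) z = WithLp.toLp 2 fun i => 2 * ∑ j : Fin 3, Q i j * z j :=
      (congrFun (gradient_quadY_eq_matCLM hQ.1) z).symm.trans ((hasGradientAt_quadY hQ.1 z).gradient)
    have := hasGradientAt_quadY hQ.1 z
    rw [hasGradientAt_iff_hasFDerivAt, ← heq] at this
    exact this
  have hV := (hA.smul hG).sub ((hB.mul hY).smul (hasFDerivAt_id z))
  -- translate
  have hT : HasFDerivAt (fun x : E3 => x - x₀) (ContinuousLinearMap.id ℝ E3) (x₀ + z) := (hasFDerivAt_id _).sub_const x₀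
  have hz : x₀ + z - x₀ = z := add_sub_cancel_left x₀ z
  rw [sepShell_eq_explicit hQ hh hHh x₀]
  have hV' := hz ▸ hV
  have hc := hV'.comp (x₀ + z) hT
  refine (hc.congr_of_eventuallyEq (Eventually.of_forall fun x => rfl)).congr_fderiv ?_
  ext v i
  simp [shellDeriv, matCLM_apply, PiLp.inner_apply, Fin.sum_univ_three, InnerProductSpace.toDual_apply_apply, two_smul]
  ring

/-- ★ THE SOURCE OF THE SLICE POISSON EQUATION, EXPLICITLY: for a quadratic form `Q`, a profile `H(r) = h(r²)` (`h` smooth) and the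
smooth divergence-free shell `u₀ = sepShell H Q x₀`,
`div((u₀·∇)u₀)(x₀ + z) = tr Q²·ã₀(|z|²) + ã₂(|z|²)·S₂(z) + ã₄(|z|²)·S₄(z)`. -/
theorem divergence_convect_sepShell {Q : Matrix (Fin 3) (Fin 3) ℝ} (hQ : IsQuadForm Q) {H h : ℝ → ℝ}
    (hh : ContDiff ℝ (⊤ : ℕ∞) h) (hHh : ∀ r : ℝ, 0 ≤ r → H r = h (r ^ 2)) (x₀ : E3)
    (hsm : ContDiff ℝ (⊤ : ℕ∞) (sepShell H Q x₀)) (hdiv : VectorCalculus.IsDivFree (sepShell H Q x₀)) (z : E3) :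
    VectorCalculus.divergence (convect (sepShell H Q x₀) (sepShell H Q x₀)) (x₀ + z) =
      Matrix.trace (Q * Q) * chanZero h (‖z‖ ^ 2) + chanTwo h (‖z‖ ^ 2) * quadY (sqForm Q) z
        + chanFour h (‖z‖ ^ 2) * quartic Q z := by
  rw [divergence_convect_self_eq (hsm.of_le (by norm_cast)) hdiv (x₀ + z), traceCLM_apply,
    (hasFDerivAt_sepShell hQ hh hHh x₀ z).fderiv, trace_shellDeriv_comp_quadY hQ, source_channels hQ.1]

end Summit.NavierStokesRegularity.NavierStokesRegularity.Theorems.UnthreadedRigidity.HornPressure
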